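import Summits.CriticalPhenomena.PercolationContinuityZ3.Theorems.Transplant.ZdTimesFiniteStrictSlab
import Literature.Barriers.CriticalPhenomena.SubexponentialGrowthZdBurtonKeane
import Literature.Probability.LatticeModels.ThermodynamicLimitProofs
import Literature.Probability.LatticeModels.IsingThermodynamicsProofs
import Literature.Probability.LatticeModels.IsingPressureBounds
import Mathlib.Combinatorics.SimpleGraph.Prod
import HarnessLib

/-!
# `ℤ^d × F` is amenable, hence has at most one infinite cluster at every `p` (input U of rung R1)

builds on p205010 (kernel theorem, internal audit signed; external expert review pending) — nothing in this file uses p205010.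
Lane `prim-bschramm`, rung R1 (`LADDER.md` R1: "U: generic in tree (needs `IsGraphAmenable (zdGraph d □ F)` + `IsQuasiTransitive` —
NEW, routine: Følner boxes `Λ_n × F`)"); seat `prim-bschramm-p2`; helper file (`--supports stmt-CriticalPhenomena-4575`).
No definitions, no named facts, no sorries.

* `Transplant.outerBoundary_boxProd_subset` — the outer vertex boundary of `Λ × W` in `ℤ^d □ F` lies in `(∂Λ) × W` (an edge
  leaving `Λ × W` is a `ℤ^d`-edge, the `F`-edges stay in the fibre).
* `Transplant.card_incidenceFinset_zdTimesFinite_le` — degrees in `ℤ^d □ F` are `≤ 2d + |W|`.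
* `Transplant.isGraphAmenable_zdTimesFinite` — **`ℤ^d □ F` is (edge-)amenable**: the Følner boxes `B(L) × W` have
  `|∂_E(B(L) × W)| ≤ (2d + |W|)·|W|·((2L+3)^d − (2L+1)^d)` against `|B(L) × W| = (2L+1)^d |W|` (Friedli–Velenik §3.2.1 for `ℤ^d`,
  the tree's `tendsto_card_edgeBoundary_box_div` pattern, with the fibre as a passenger).
* `Transplant.zdTimesFinite_numInfiniteClusters_le_one` — **uniqueness of the infinite cluster on `ℤ^d □ F` at every `p`**
  (`F` finite connected): Burton–Keane for connected quasi-transitive amenable graphs, the tree's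
  `BurtonKeane1989_atMostOneInfiniteCluster_holds`, with `zdTimesFinite_isQuasiTransitive` / `zdTimesFinite_connected`
  (`Transplant/ZdTimesFiniteStrictSlab.lean`).  This is input U of block (D) (KN Lemma 7) for the rung.

[cite: LyonsPeres2016, §6.1 (edge amenable) and Thm. 7.6] [cite: FriedliVelenik2017, §3.2.1, Exercise 3.1] [cite: BurtonKeane1989, Thm. 2]
[cite: BenjaminiSchramm1996, §4 (remark after Conj. 5: Burton–Keane for almost transitive graphs with Cheeger constant zero)]
-/

noncomputable section

namespace Summit.CriticalPhenomena.PercolationContinuityZ3.Theorems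

namespace Transplant

open MeasureTheory Filter Topology Finset
open Literature.Probability.Percolation Literature.Probability.LatticeModels
open Literature.Barriers.CriticalPhenomena

variable {d : ℕ} {W : Type} [Fintype W] [DecidableEq W] (F : SimpleGraph W) [DecidableRel F.Adj]

/-- The outer vertex boundary of a cylinder `Λ × W` in `ℤ^d □ F` lies in `(∂^{out} Λ) × W`. [folklore] -/
theorem outerBoundary_boxProd_subset (Λ : Finset (Site d)) :
    outerBoundary (zdGraph d □ F) (Λ ×ˢ (Finset.univ : Finset W)) ⊆ outerBoundary (zdGraph d) Λ ×ˢ Finset.univ := by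
  intro v hv
  rw [mem_outerBoundary_iff] at hv
  obtain ⟨hvΛ, u, hu, hadj⟩ := hv
  rw [Finset.mem_product] at hu hvΛ ⊢
  refine ⟨?_, Finset.mem_univ _⟩
  rw [mem_outerBoundary_iff]
  have hv1 : v.1 ∉ Λ := fun h => hvΛ ⟨h, Finset.mem_univ _⟩
  refine ⟨hv1, ?_⟩
  rcases (SimpleGraph.boxProd_adj.1 hadj) with ⟨h1, -⟩ | ⟨-, h2⟩
  · exact ⟨u.1, hu.1, h1⟩
  · exact absurd (h2 ▸ hu.1) hv1

/-- Degrees in `ℤ^d □ F` are at most `2d + |W|`. [folklore] -/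
theorem card_incidenceFinset_zdTimesFinite_le (v : Site d × W) :
    #((zdGraph d □ F).incidenceFinset v) ≤ 2 * d + Fintype.card W := by
  classical
  rw [SimpleGraph.card_incidenceFinset_eq_degree, SimpleGraph.degree_boxProd]
  have h1 : (zdGraph d).degree v.1 ≤ 2 * d := by
    rw [← SimpleGraph.card_incidenceFinset_eq_degree]; exact card_incidenceFinset_zdGraph_le v.1
  have h2 : F.degree v.2 ≤ Fintype.card W := (SimpleGraph.degree_lt_card_verts v.2).le
  omega

/-- The edge boundary of the Følner box `B(L) × W`: `|∂_E(B(L) × W)| ≤ (2d + |W|)·|W|·((2L+3)^d − (2L+1)^d)`.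
[cite: FriedliVelenik2017, §3.2.1, Exercise 3.1] -/
theorem card_edgeBoundary_boxProd_le (L : ℕ) :
    (#(edgeBoundary (zdGraph d □ F) (box d L ×ˢ (Finset.univ : Finset W))) : ℝ) ≤
      (2 * d + Fintype.card W) * (Fintype.card W * ((2 * (L : ℝ) + 3) ^ d - (2 * (L : ℝ) + 1) ^ d)) := by
  have h3 := card_edgeBoundary_le_of_degree_le (zdGraph d □ F) (card_incidenceFinset_zdTimesFinite_le F)
    (box d L ×ˢ (Finset.univ : Finset W))
  have h4 : #(outerBoundary (zdGraph d □ F) (box d L ×ˢ (Finset.univ : Finset W))) ≤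
      #(outerBoundary (zdGraph d) (box d L)) * Fintype.card W := by
    have := Finset.card_le_card (outerBoundary_boxProd_subset F (box d L))
    rwa [Finset.card_product, Finset.card_univ] at this
  have h5 : (#(outerBoundary (zdGraph d) (box d L)) : ℝ) + (2 * (L : ℝ) + 1) ^ d ≤ (2 * (L : ℝ) + 3) ^ d := by
    exact_mod_cast card_outerBoundary_box_add_le d L
  have hW : (0 : ℝ) ≤ Fintype.card W := Nat.cast_nonneg _
  calc (#(edgeBoundary (zdGraph d □ F) (box d L ×ˢ (Finset.univ : Finset W))) : ℝ)
      ≤ ((2 * d + Fintype.card W) * #(outerBoundary (zdGraph d □ F) (box d L ×ˢ (Finset.univ : Finset W))) : ℕ) := by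
        exact_mod_cast h3
    _ ≤ ((2 * d + Fintype.card W) * (#(outerBoundary (zdGraph d) (box d L)) * Fintype.card W) : ℕ) := by
        exact_mod_cast Nat.mul_le_mul_left _ h4
    _ = (2 * d + Fintype.card W) * (Fintype.card W * (#(outerBoundary (zdGraph d) (box d L)) : ℝ)) := by
        push_cast; ring
    _ ≤ (2 * d + Fintype.card W) * (Fintype.card W * ((2 * (L : ℝ) + 3) ^ d - (2 * (L : ℝ) + 1) ^ d)) := by
        refine mul_le_mul_of_nonneg_left (mul_le_mul_of_nonneg_left (by linarith) hW) (by positivity)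

/-- **`ℤ^d □ F` is (edge-)amenable** (`F` on a finite vertex type `W`; for `W` empty the graph is empty and the statement is
vacuous-true by the same boxes): Følner boxes `B(L) × W`. [cite: LyonsPeres2016, §6.1 (Φ_E = 0, edge amenable)]
[cite: FriedliVelenik2017, §3.2.1 (boxes are van Hove)] -/
theorem isGraphAmenable_zdTimesFinite [Nonempty W] : IsGraphAmenable (zdGraph d □ F) := by
  intro ε hε
  -- the ratio bound tends to zero
  have h0 : Tendsto (fun L : ℕ => 2 * (L : ℝ) + 1) atTop atTop :=
    tendsto_atTop_mono (fun L => by linarith [(Nat.cast_nonneg L : (0 : ℝ) ≤ L)]) tendsto_natCast_atTop_atTop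
  have he : Tendsto (fun L : ℕ => ((2 * d + Fintype.card W : ℝ)) *
      (((2 * (L : ℝ) + 1 + 2) ^ d - (2 * (L : ℝ) + 1) ^ d) / (2 * (L : ℝ) + 1) ^ d)) atTop (𝓝 0) := by
    have h1 := (tendsto_pow_add_two_sub_pow_div d h0).const_mul ((2 * d + Fintype.card W : ℝ))
    rwa [mul_zero] at h1
  obtain ⟨L, hL⟩ := (he.eventually (gt_mem_nhds hε)).exists
  refine ⟨box d L ×ˢ (Finset.univ : Finset W), ?_, ?_⟩
  · exact Finset.Nonempty.product (box_nonempty d L) Finset.univ_nonempty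
  · have hcard : (#(box d L ×ˢ (Finset.univ : Finset W)) : ℝ) = (2 * (L : ℝ) + 1) ^ d * Fintype.card W := by
      rw [Finset.card_product, Finset.card_univ, card_box]; push_cast; ring
    have hpow : (0 : ℝ) < (2 * (L : ℝ) + 1) ^ d := by positivity
    have hW : (0 : ℝ) < Fintype.card W := by exact_mod_cast Fintype.card_pos
    have hratio : ((2 * d + Fintype.card W : ℝ)) * ((2 * (L : ℝ) + 3) ^ d - (2 * (L : ℝ) + 1) ^ d) ≤
        ε * (2 * (L : ℝ) + 1) ^ d := by
      have := hL.le
      rw [show (2 * (L : ℝ) + 1 + 2) = 2 * L + 3 by ring, mul_div_assoc', div_le_iff₀ hpow] at this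
      exact this
    calc (#(edgeBoundary (zdGraph d □ F) (box d L ×ˢ (Finset.univ : Finset W))) : ℝ)
        ≤ (2 * d + Fintype.card W) * (Fintype.card W * ((2 * (L : ℝ) + 3) ^ d - (2 * (L : ℝ) + 1) ^ d)) :=
          card_edgeBoundary_boxProd_le F L
      _ = Fintype.card W * ((2 * d + Fintype.card W) * ((2 * (L : ℝ) + 3) ^ d - (2 * (L : ℝ) + 1) ^ d)) := by ring
      _ ≤ Fintype.card W * (ε * (2 * (L : ℝ) + 1) ^ d) := mul_le_mul_of_nonneg_left hratio hW.le
      _ = ε * #(box d L ×ˢ (Finset.univ : Finset W)) := by rw [hcard]; ring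

/-- **Uniqueness of the infinite cluster on `ℤ^d × F` at every `p`** (`F` finite connected): input U of the rung R1, by
Burton–Keane for connected quasi-transitive amenable graphs (`BurtonKeane1989_atMostOneInfiniteCluster_holds`).
[cite: BurtonKeane1989, Thm. 2] [cite: LyonsPeres2016, Thm. 7.6] [cite: BenjaminiSchramm1996, §4] -/
theorem zdTimesFinite_numInfiniteClusters_le_one (hF : F.Connected) (p : unitInterval) :
    ∀ᵐ ω ∂(bondPercolation (zdGraph d □ F) p), numInfiniteClusters ω ≤ 1 := by
  haveI : Nonempty W := hF.nonempty
  exact BurtonKeane1989_atMostOneInfiniteCluster_holds (zdGraph d □ F) (zdTimesFinite_connected F hF)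
    (zdTimesFinite_isQuasiTransitive F) (isGraphAmenable_zdTimesFinite F) p

end Transplant

end Summit.CriticalPhenomena.PercolationContinuityZ3.Theorems

end
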